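import Literature.MathematicalPhysics.KineticTheory.HardSphereEuler
import Literature.Analysis.FunctionSpaces.TorusCalculus
import Literature.Analysis.FunctionSpaces.TorusChainRule
import HarnessLib

/-!
# The hard-sphere compressible Euler system on `𝕋³` in primitive variables, and the
# relative-energy balance of two classical solutions (pointwise identities)

MathematicalPhysics/KineticTheory proof file (theorems only; no definitions, no named facts),
first half of the UNIQUENESS layer of the local theory of classical solutions
`IsHardSphereEulerSolution σ T ρ u θ` (`HardSphereEuler.lean`: `ρ, u, θ` jointly `C^∞` on
`[0, T) × 𝕋³`, `ρ, θ > 0`, mass / momentum / energy conservation in CONSERVATIVE form against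
`Torus.timeDerivWithin (Ico 0 T)` / `Torus.divergence` / `Torus.partialDeriv` / `Torus.gradient`,
pressure `p = hsPressure σ ρ θ`). The energy method for the difference of two solutions
(C. M. Dafermos, *Hyperbolic Conservation Laws in Continuum Physics*, 2nd ed. 2005, Ch. V,
Thm 5.2.1 — `L²`-stability, hence uniqueness, of classical solutions of symmetrisable systems
within a broader class; here only classical-vs-classical, which is the relative-energy /
symmetrised-`L²` computation of its proof) needs the PRIMITIVE form of the system, pointwise on
`[0, T) × 𝕋³` and in coordinates `i, j : Fin 3`, for a pressure field of the form
`p = ρ θ ζ(ρ)` with `ζ` smooth on an open set `J ⊆ ℝ` containing the values of the density (for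
the hard-sphere law `p = ρ θ Z(ρσ³)` this is `ζ r = Z(rσ³)` once `Z` is known to be smooth on the
packing range; at `σ = 0` it is `ζ = 1`; NOTHING about `hsCompressibility` itself is assumed —
the pressure law enters only through the pointwise hypothesis `hp`):

* `IsHardSphereEulerSolution.timeDeriv_density_eq` — `∂ₜρ = -Σᵢ (ρ ∂ᵢuᵢ + ∂ᵢρ uᵢ)`;
* `IsHardSphereEulerSolution.density_mul_timeDeriv_velocity_eq` —
  `ρ ∂ₜuⱼ = -ρ Σᵢ uᵢ ∂ᵢuⱼ - (θ (ζ(ρ) + ρ ζ'(ρ)) ∂ⱼρ + ρ ζ(ρ) ∂ⱼθ)`;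
* `IsHardSphereEulerSolution.timeDeriv_temperature_eq` —
  `∂ₜθ = -Σᵢ uᵢ ∂ᵢθ - (2/3) θ ζ(ρ) Σᵢ ∂ᵢuᵢ`;
* `IsHardSphereEulerSolution.relativeEnergy_balance` — for TWO solutions with the same law `ζ`,
  the symmetrised energy density `e = ½ (A α² + ρ |w|² + B β²)` of the difference
  `(α, w, β) = (ρ - ρ', u - u', θ - θ')`, weights `A = θ γ(ρ)/ρ` (`γ = ζ + id·ζ' = ∂_ρ p / θ`),
  `B = 3ρ/(2θ)` (the Friedrichs symmetriser `diag(p_ρ/ρ, ρ, ρ, ρ, 3ρ/(2θ))` of the system in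
  the unknowns `(ρ, u, θ)`), and fluxes
  `Φᵢ = ½ (A uᵢ α² + ρ uᵢ |w|² + B uᵢ β²) + θγ(ρ) α wᵢ + ρζ(ρ) β wᵢ` satisfy the pointwise
  identity `∂ₜe + Σᵢ ∂ᵢΦᵢ = R` with an EXPLICIT zero-order remainder `R`, a bilinear form in
  `α, β, wⱼ, ζ(ρ) - ζ(ρ'), γ(ρ) - γ(ρ')` whose coefficients are polynomials in the two
  solutions, their first derivatives and the derivatives of the weights — no derivative of
  `α, β, w` survives, because the weights symmetrise the system (`A ρ = θ γ(ρ)`, `2 B θ = 3 ρ`).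

The Grönwall step (uniqueness proper) is in the sibling `HardSphereEulerClassicalUniqueness.lean`.
Calculus: product and chain rules along coordinate lines (`Torus.hasDerivAt_comp_add_proj_smul`)
and time slices (`Torus.IsSmoothSpaceTimeOn.hasDerivWithinAt_slice`); algebra: the primitive
equations fed to `linear_combination`. The small pointwise-calculus helpers live in the
sub-namespace `HsEulerCalc` (so that their short names do not collide with the summit-side
copies from which this file was ported: `Summits/AtomisticToContinuum/HydrodynamicLimit/Theorems/
ImplosionDichotomyPolynomialCompressionUniqueness{Primitive,Identity}.lean`, which Literature may
not import, CONVENTIONS §2).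

## Mathlib / tree search

Tree: `Torus.hasDerivAt_comp_add_proj_smul`, `Torus.partialDeriv_mul`,
`Torus.partialDeriv_apply_coord`, `Torus.gradient_eq_sum_partialDeriv`,
`Torus.IsSmoothSpaceTimeOn.{isSmooth_slice, hasDerivWithinAt_slice, smul, apply}`
(`TorusCalculus*.lean`, `TorusSpaceTime.lean`, `TorusChainRule.lean`);
`Literature.Analysis.FluidPDE.CompressibleEuler.{massEq,momentumEq,temperatureEq}_pointData`
(`ClassicalEulerPointData.lean`) are the analogous point relations for
`IsClassicalEulerSolution eos` under `eos.IsGibbs` (thermodynamic packaging not available for the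
bare pressure hypothesis used here). Mathlib: `HasDerivAt.fun_mul`, `HasDerivWithinAt.derivWithin`,
`linear_combination`.

## References

* C. M. Dafermos, *Hyperbolic Conservation Laws in Continuum Physics*, 2nd ed., Grundlehren 325,
  Springer 2005: Ch. V, §5.2, Thm 5.2.1 (and §5.1, the symmetriser of Thm 5.1.1). [`Dafermos2005`]
* A. Majda, *Compressible Fluid Flow and Systems of Conservation Laws in Several Space
  Variables*, Appl. Math. Sci. 53, Springer 1984: Ch. 1 (the Euler system of gas dynamics in the
  unknowns `(p, u, S)` / `(ρ, u, θ)` and its symmetriser); Ch. 2, proof of Thm 2.1 (uniqueness by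
  the `L²` energy estimate for the difference). [`Majda1984`]
-/

noncomputable section

open Set Filter MeasureTheory
open _root_.Topology
open scoped ContDiff

namespace Literature.MathematicalPhysics.KineticTheory

open Literature.Analysis.FunctionSpaces

namespace HsEulerCalc

/-! ### Pointwise calculus along coordinate lines and time slices -/

/-- A `C¹` scalar function on `𝕋³` restricted to the `i`-th coordinate line through `x` has
derivative `∂ᵢa(x)` at parameter `0`. [folklore] -/
theorem hasDerivAt_coordLine {a : T3 → ℝ} (ha : Torus.IsContDiff 1 a) (x : T3) (i : Fin 3) :
    HasDerivAt (fun s : ℝ => a (x + Torus.proj (s • EuclideanSpace.single i (1 : ℝ))))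
      (Torus.partialDeriv i a x) 0 := by
  have h := Torus.hasDerivAt_comp_add_proj_smul ha x (EuclideanSpace.single i (1 : ℝ)) 0
  simp only [zero_smul, Torus.proj_zero, add_zero] at h
  exact h

/-- Chain rule along a coordinate line: `s ↦ ζ(a(x + s eᵢ))` has derivative `ζ'(a x) ∂ᵢa(x)` at
`0` when `ζ` is smooth on an open set containing `a x`. [folklore] -/
theorem hasDerivAt_coordLine_comp {a : T3 → ℝ} (ha : Torus.IsContDiff 1 a) {ζ : ℝ → ℝ}
    {J : Set ℝ} (hJ : IsOpen J) (hζ : ContDiffOn ℝ ∞ ζ J) (x : T3) (hx : a x ∈ J) (i : Fin 3) :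
    HasDerivAt (fun s : ℝ => ζ (a (x + Torus.proj (s • EuclideanSpace.single i (1 : ℝ)))))
      (deriv ζ (a x) * Torus.partialDeriv i a x) 0 := by
  have hd : HasDerivAt ζ (deriv ζ (a x)) (a x) :=
    ((hζ.differentiableOn (by simp)).differentiableAt (hJ.mem_nhds hx)).hasDerivAt
  have hd' : HasDerivAt ζ (deriv ζ (a x))
      (a (x + Torus.proj ((0 : ℝ) • EuclideanSpace.single i (1 : ℝ)))) := by
    simpa only [zero_smul, Torus.proj_zero, add_zero] using hd
  exact hd'.comp (0 : ℝ) (hasDerivAt_coordLine ha x i)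

/-- The partial derivative `∂ᵢF(x)` is the derivative of `F` along the `i`-th coordinate line
through `x` (by definition; uniqueness of derivatives). [folklore] -/
theorem partialDeriv_eq_of_hasDerivAt {F : T3 → ℝ} {x : T3} {i : Fin 3} {f' : ℝ}
    (h : HasDerivAt (fun s : ℝ => F (x + Torus.proj (s • EuclideanSpace.single i (1 : ℝ)))) f' 0) :
    Torus.partialDeriv i F x = f' :=
  h.deriv

/-- The one-sided time derivative is read off from a `HasDerivWithinAt` of the time slice
(uniqueness of one-sided derivatives on sets of unique differentiability). [folklore] -/
theorem timeDerivWithin_eq_of_hasDerivWithinAt {S : Set ℝ} {F : ℝ → T3 → ℝ} {t : ℝ} {x : T3}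
    {f' : ℝ} (h : HasDerivWithinAt (fun τ : ℝ => F τ x) f' S t) (hS : UniqueDiffWithinAt ℝ S t) :
    Torus.timeDerivWithin S F t x = f' :=
  h.derivWithin hS

/-- Coordinates commute with one-sided time derivatives of jointly smooth vector fields.
[folklore] -/
theorem timeDerivWithin_apply_coord {S : Set ℝ} {F : ℝ → T3 → V3}
    (hF : Torus.IsSmoothSpaceTimeOn S F) (hS : UniqueDiffOn ℝ S) {t : ℝ} (ht : t ∈ S) (x : T3)
    (j : Fin 3) :
    Torus.timeDerivWithin S (fun s y => F s y j) t x = Torus.timeDerivWithin S F t x j :=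
  ((EuclideanSpace.proj j : V3 →L[ℝ] ℝ).hasFDerivAt.comp_hasDerivWithinAt t
    (hF.hasDerivWithinAt_slice ht x)).derivWithin (hS t ht)

/-- Coordinates of the torus gradient are the partial derivatives. [folklore] -/
theorem gradient_apply_eq_partialDeriv {p : T3 → ℝ} (hp : Torus.IsContDiff 1 p) (x : T3)
    (j : Fin 3) : Torus.gradient p x j = Torus.partialDeriv j p x := by
  rw [Torus.gradient_eq_sum_partialDeriv hp]
  simp [Finset.sum_apply, Pi.single_apply]

/-- Coordinates of a `C¹` vector field on `𝕋³` are `C¹`. [folklore] -/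
theorem isContDiff_apply_coord {v : T3 → V3} (hv : Torus.IsContDiff 1 v) (j : Fin 3) :
    Torus.IsContDiff 1 (fun y => v y j) :=
  (EuclideanSpace.proj j : V3 →L[ℝ] ℝ).contDiff.comp hv

/-! ### The primitive equations -/

end HsEulerCalc

open HsEulerCalc

section Primitive

variable {σ T : ℝ} {ρ θ : ℝ → T3 → ℝ} {u : ℝ → T3 → V3} {ζ : ℝ → ℝ} {J : Set ℝ}

/-- **Mass equation in primitive form**: along a classical hard-sphere–Euler solution,
`∂ₜρ = -Σᵢ (ρ ∂ᵢuᵢ + ∂ᵢρ uᵢ)` pointwise on `[0, T) × 𝕋³`. [folklore] -/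
theorem IsHardSphereEulerSolution.timeDeriv_density_eq (hE : IsHardSphereEulerSolution σ T ρ u θ)
    {t : ℝ} (ht : t ∈ Ico 0 T) (x : T3) :
    Torus.timeDerivWithin (Ico 0 T) ρ t x =
      -∑ i, (ρ t x * Torus.partialDeriv i (fun y => u t y i) x +
        Torus.partialDeriv i (ρ t) x * u t x i) := by
  have hρ1 : Torus.IsContDiff 1 (ρ t) := (hE.smooth_density.isSmooth_slice ht).isContDiff (by simp)
  have hu1 : Torus.IsContDiff 1 (u t) := (hE.smooth_velocity.isSmooth_slice ht).isContDiff (by simp)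
  have hdiv : Torus.divergence (fun y => ρ t y • u t y) x =
      ∑ i, (ρ t x * Torus.partialDeriv i (fun y => u t y i) x +
        Torus.partialDeriv i (ρ t) x * u t x i) := by
    unfold Torus.divergence
    refine Finset.sum_congr rfl fun i _ => ?_
    have hfun : (fun y => (ρ t y • u t y) i) = fun y => ρ t y * u t y i := by
      funext y; simp [smul_eq_mul]
    rw [hfun]
    exact Torus.partialDeriv_mul hρ1 (isContDiff_apply_coord hu1 i) i x
  linear_combination hE.mass t ht x - hdiv

/-- **Momentum equation in primitive form**: along a classical hard-sphere–Euler solution whose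
pressure field is `ρ θ ζ(ρ)` for a function `ζ` smooth on an open set containing the values of
the density, `ρ ∂ₜuⱼ = -ρ Σᵢ uᵢ ∂ᵢuⱼ - (θ (ζ(ρ) + ρ ζ'(ρ)) ∂ⱼρ + ρ ζ(ρ) ∂ⱼθ)` pointwise on
`[0, T) × 𝕋³` (`∂ⱼp = p_ρ ∂ⱼρ + p_θ ∂ⱼθ`; the mass equation cancels `uⱼ(∂ₜρ + div(ρu))`).
[folklore] -/
theorem IsHardSphereEulerSolution.density_mul_timeDeriv_velocity_eq
    (hE : IsHardSphereEulerSolution σ T ρ u θ) (hJ : IsOpen J)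
    (hζ : ContDiffOn ℝ ∞ ζ J) (hρJ : ∀ t ∈ Ico 0 T, ∀ x, ρ t x ∈ J)
    (hp : ∀ t ∈ Ico 0 T, ∀ x, hsPressure σ (ρ t x) (θ t x) = ρ t x * θ t x * ζ (ρ t x))
    {t : ℝ} (ht : t ∈ Ico 0 T) (x : T3) (j : Fin 3) :
    ρ t x * Torus.timeDerivWithin (Ico 0 T) (fun s y => u s y j) t x =
      -(ρ t x * ∑ i, u t x i * Torus.partialDeriv i (fun y => u t y j) x) -
        (θ t x * (ζ (ρ t x) + ρ t x * deriv ζ (ρ t x)) * Torus.partialDeriv j (ρ t) x +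
          ρ t x * ζ (ρ t x) * Torus.partialDeriv j (θ t) x) := by
  have hU : UniqueDiffOn ℝ (Ico (0 : ℝ) T) := uniqueDiffOn_Ico 0 T
  have hρ1 : Torus.IsContDiff 1 (ρ t) := (hE.smooth_density.isSmooth_slice ht).isContDiff (by simp)
  have hθ1 : Torus.IsContDiff 1 (θ t) :=
    (hE.smooth_temperature.isSmooth_slice ht).isContDiff (by simp)
  have hu1 : Torus.IsContDiff 1 (u t) := (hE.smooth_velocity.isSmooth_slice ht).isContDiff (by simp)
  have huj1 : ∀ i, Torus.IsContDiff 1 (fun y => u t y i) := fun i => isContDiff_apply_coord hu1 i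
  have hζ1 : Torus.IsContDiff 1 (fun y => ζ (ρ t y)) :=
    (hζ.of_le (by simp)).comp_contDiff hρ1 fun v => hρJ t ht _
  -- coordinate-line derivatives of the basic fields at `x`
  have cρ := fun i => hasDerivAt_coordLine hρ1 x i
  have cθ := fun i => hasDerivAt_coordLine hθ1 x i
  have cu := fun i k => hasDerivAt_coordLine (huj1 k) x i
  have cζ := fun i => hasDerivAt_coordLine_comp hρ1 hJ hζ x (hρJ t ht x) i
  -- the `j`-th coordinate of the momentum equation
  have hmj : (Torus.timeDerivWithin (Ico 0 T) (fun s y => ρ s y • u s y) t x +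
      (∑ i, Torus.partialDeriv i (fun y => (ρ t y * u t y i) • u t y) x) +
      Torus.gradient (fun y => hsPressure σ (ρ t y) (θ t y)) x) j = 0 := by
    rw [hE.momentum t ht x]; rfl
  -- (1) `∂ₜ(ρuⱼ) = ∂ₜρ uⱼ + ρ ∂ₜuⱼ`
  have hA : (Torus.timeDerivWithin (Ico 0 T) (fun s y => ρ s y • u s y) t x) j =
      Torus.timeDerivWithin (Ico 0 T) ρ t x * u t x j +
        ρ t x * Torus.timeDerivWithin (Ico 0 T) (fun s y => u s y j) t x := by
    rw [← timeDerivWithin_apply_coord (hE.smooth_density.smul hE.smooth_velocity) hU ht x j]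
    have hfun : (fun s y => (ρ s y • u s y) j) = fun s y => ρ s y * u s y j := by
      funext s y; simp [smul_eq_mul]
    rw [hfun]
    exact timeDerivWithin_eq_of_hasDerivWithinAt
      (((hE.smooth_density.hasDerivWithinAt_slice ht x).fun_mul
        ((hE.smooth_velocity.apply j).hasDerivWithinAt_slice ht x)).congr_deriv (by ring)) (hU t ht)
  -- (2) `Σᵢ ∂ᵢ(ρuᵢuⱼ) = Σᵢ (ρuᵢ ∂ᵢuⱼ + (ρ ∂ᵢuᵢ + ∂ᵢρ uᵢ) uⱼ)`
  have hB : (∑ i, Torus.partialDeriv i (fun y => (ρ t y * u t y i) • u t y) x) j =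
      ∑ i, (ρ t x * u t x i * Torus.partialDeriv i (fun y => u t y j) x +
        (ρ t x * Torus.partialDeriv i (fun y => u t y i) x +
          Torus.partialDeriv i (ρ t) x * u t x i) * u t x j) := by
    have hsum : (∑ i, Torus.partialDeriv i (fun y => (ρ t y * u t y i) • u t y) x) j =
        ∑ i, Torus.partialDeriv i (fun y => (ρ t y * u t y i) • u t y) x j := by simp
    rw [hsum]
    refine Finset.sum_congr rfl fun i _ => ?_
    have hF1 : Torus.IsContDiff 1 (fun y => (ρ t y * u t y i) • u t y) :=
      ((hρ1.mul (huj1 i)).smul hu1 :)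
    rw [← Torus.partialDeriv_apply_coord hF1 i x j]
    have hfun : (fun y => ((ρ t y * u t y i) • u t y) j) = fun y => ρ t y * u t y i * u t y j := by
      funext y; simp [smul_eq_mul]
    rw [hfun]
    exact partialDeriv_eq_of_hasDerivAt ((((cρ i).fun_mul (cu i i)).fun_mul (cu i j)).congr_deriv
      (by simp only [zero_smul, Torus.proj_zero, add_zero]; ring))
  -- (3) `∂ⱼp = θ (ζ(ρ) + ρ ζ'(ρ)) ∂ⱼρ + ρ ζ(ρ) ∂ⱼθ`
  have hC : (Torus.gradient (fun y => hsPressure σ (ρ t y) (θ t y)) x) j =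
      θ t x * (ζ (ρ t x) + ρ t x * deriv ζ (ρ t x)) * Torus.partialDeriv j (ρ t) x +
        ρ t x * ζ (ρ t x) * Torus.partialDeriv j (θ t) x := by
    have hpf : (fun y => hsPressure σ (ρ t y) (θ t y)) = fun y => ρ t y * θ t y * ζ (ρ t y) :=
      funext (hp t ht)
    have hp1 : Torus.IsContDiff 1 (fun y => ρ t y * θ t y * ζ (ρ t y)) := ((hρ1.mul hθ1).mul hζ1 :)
    rw [hpf, gradient_apply_eq_partialDeriv hp1 x j]
    exact partialDeriv_eq_of_hasDerivAt ((((cρ j).fun_mul (cθ j)).fun_mul (cζ j)).congr_deriv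
      (by simp only [zero_smul, Torus.proj_zero, add_zero]; ring))
  have hP1 := hE.timeDeriv_density_eq ht x
  have hmj' : Torus.timeDerivWithin (Ico 0 T) ρ t x * u t x j +
      ρ t x * Torus.timeDerivWithin (Ico 0 T) (fun s y => u s y j) t x +
      (∑ i, (ρ t x * u t x i * Torus.partialDeriv i (fun y => u t y j) x +
        (ρ t x * Torus.partialDeriv i (fun y => u t y i) x +
          Torus.partialDeriv i (ρ t) x * u t x i) * u t x j)) +
      (θ t x * (ζ (ρ t x) + ρ t x * deriv ζ (ρ t x)) * Torus.partialDeriv j (ρ t) x +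
        ρ t x * ζ (ρ t x) * Torus.partialDeriv j (θ t) x) = 0 := by
    have h := hmj
    simp only [PiLp.add_apply] at h
    rwa [hA, hB, hC] at h
  simp only [Fin.sum_univ_three] at hmj' hP1 ⊢
  linear_combination hmj' - (u t x j) * hP1

/-- **Temperature equation in primitive form**: along a classical hard-sphere–Euler solution whose
pressure field is `ρ θ ζ(ρ)` for a function `ζ` smooth on an open set containing the values of
the density, `∂ₜθ = -Σᵢ uᵢ ∂ᵢθ - (2/3) θ ζ(ρ) Σᵢ ∂ᵢuᵢ` pointwise on `[0, T) × 𝕋³` (energy equation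
minus `(|u|²/2 + 3θ/2)`·mass minus `u`·momentum, divided by `(3/2)ρ > 0`). [folklore] -/
theorem IsHardSphereEulerSolution.timeDeriv_temperature_eq :
    ∀ {σ T : ℝ} {ρ θ : ℝ → T3 → ℝ} {u : ℝ → T3 → V3} {ζ : ℝ → ℝ} {J : Set ℝ},
      IsHardSphereEulerSolution σ T ρ u θ → IsOpen J → ContDiffOn ℝ (⊤ : ℕ∞) ζ J →
      (∀ t ∈ Ico 0 T, ∀ x, ρ t x ∈ J) →
      (∀ t ∈ Ico 0 T, ∀ x, hsPressure σ (ρ t x) (θ t x) = ρ t x * θ t x * ζ (ρ t x)) →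
      ∀ {t : ℝ}, t ∈ Ico 0 T → ∀ x : T3,
        Torus.timeDerivWithin (Ico 0 T) θ t x =
          -(∑ i, u t x i * Torus.partialDeriv i (θ t) x) -
            2 / 3 * (θ t x * ζ (ρ t x)) * ∑ i, Torus.partialDeriv i (fun y => u t y i) x := by
  intro σ T ρ θ u ζ J hE hJ hζ hρJ hp t ht x
  have hU : UniqueDiffOn ℝ (Ico (0 : ℝ) T) := uniqueDiffOn_Ico 0 T
  have hρ1 : Torus.IsContDiff 1 (ρ t) := (hE.smooth_density.isSmooth_slice ht).isContDiff (by simp)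
  have hθ1 : Torus.IsContDiff 1 (θ t) :=
    (hE.smooth_temperature.isSmooth_slice ht).isContDiff (by simp)
  have hu1 : Torus.IsContDiff 1 (u t) := (hE.smooth_velocity.isSmooth_slice ht).isContDiff (by simp)
  have huj1 : ∀ i, Torus.IsContDiff 1 (fun y => u t y i) := fun i => isContDiff_apply_coord hu1 i
  -- coordinate-line derivatives of the basic fields at `x`
  have cρ := fun i => hasDerivAt_coordLine hρ1 x i
  have cθ := fun i => hasDerivAt_coordLine hθ1 x i
  have cu := fun i k => hasDerivAt_coordLine (huj1 k) x i
  have cζ := fun i => hasDerivAt_coordLine_comp hρ1 hJ hζ x (hρJ t ht x) i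
  -- time-slice derivatives
  have sρ := hE.smooth_density.hasDerivWithinAt_slice ht x
  have sθ := hE.smooth_temperature.hasDerivWithinAt_slice ht x
  have su := fun k => (hE.smooth_velocity.apply k).hasDerivWithinAt_slice ht x
  -- the energy density and the energy flux in coordinates
  have hEf : (fun s y => totalEnergyDensity (ρ s y) (u s y) (θ s y)) = fun s y =>
      ρ s y * (((u s y 0) ^ 2 + (u s y 1) ^ 2 + (u s y 2) ^ 2) / 2 + 3 / 2 * θ s y) := by
    funext s y
    simp only [totalEnergyDensity, EuclideanSpace.norm_sq_eq, Fin.sum_univ_three, Real.norm_eq_abs,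
      sq_abs]
  have hFf : ∀ i, (fun y => ((totalEnergyDensity (ρ t y) (u t y) (θ t y) +
      hsPressure σ (ρ t y) (θ t y)) • u t y) i) = fun y =>
      (ρ t y * (((u t y 0) ^ 2 + (u t y 1) ^ 2 + (u t y 2) ^ 2) / 2 + 3 / 2 * θ t y) +
        ρ t y * θ t y * ζ (ρ t y)) * u t y i := by
    intro i
    funext y
    simp only [PiLp.smul_apply, smul_eq_mul, totalEnergyDensity, EuclideanSpace.norm_sq_eq,
      Fin.sum_univ_three, Real.norm_eq_abs, sq_abs, hp t ht y]
  -- the energy equation in coordinates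
  have hen := hE.energy t ht x
  rw [hEf] at hen
  unfold Torus.divergence at hen
  simp only [hFf] at hen
  -- (1) the time derivative of the energy density
  have hA : Torus.timeDerivWithin (Ico 0 T) (fun s y =>
      ρ s y * (((u s y 0) ^ 2 + (u s y 1) ^ 2 + (u s y 2) ^ 2) / 2 + 3 / 2 * θ s y)) t x =
      Torus.timeDerivWithin (Ico 0 T) ρ t x *
          (((u t x 0) ^ 2 + (u t x 1) ^ 2 + (u t x 2) ^ 2) / 2 + 3 / 2 * θ t x) +
        ρ t x * (u t x 0 * Torus.timeDerivWithin (Ico 0 T) (fun s y => u s y 0) t x +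
          u t x 1 * Torus.timeDerivWithin (Ico 0 T) (fun s y => u s y 1) t x +
          u t x 2 * Torus.timeDerivWithin (Ico 0 T) (fun s y => u s y 2) t x +
          3 / 2 * Torus.timeDerivWithin (Ico 0 T) θ t x) :=
    timeDerivWithin_eq_of_hasDerivWithinAt ((sρ.fun_mul
      ((((((su 0).fun_pow 2).fun_add ((su 1).fun_pow 2)).fun_add ((su 2).fun_pow 2)).div_const
        2).fun_add (sθ.const_mul (3 / 2)))).congr_deriv (by ring)) (hU t ht)
  -- (2) the divergence of the energy flux, coordinate by coordinate
  have hB : ∀ i, Torus.partialDeriv i (fun y =>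
      (ρ t y * (((u t y 0) ^ 2 + (u t y 1) ^ 2 + (u t y 2) ^ 2) / 2 + 3 / 2 * θ t y) +
        ρ t y * θ t y * ζ (ρ t y)) * u t y i) x =
      (ρ t x * (((u t x 0) ^ 2 + (u t x 1) ^ 2 + (u t x 2) ^ 2) / 2 + 3 / 2 * θ t x) +
        ρ t x * θ t x * ζ (ρ t x)) * Torus.partialDeriv i (fun y => u t y i) x +
      ((Torus.partialDeriv i (ρ t) x * (((u t x 0) ^ 2 + (u t x 1) ^ 2 + (u t x 2) ^ 2) / 2 +
          3 / 2 * θ t x) +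
        ρ t x * (u t x 0 * Torus.partialDeriv i (fun y => u t y 0) x +
          u t x 1 * Torus.partialDeriv i (fun y => u t y 1) x +
          u t x 2 * Torus.partialDeriv i (fun y => u t y 2) x +
          3 / 2 * Torus.partialDeriv i (θ t) x)) +
        (θ t x * (ζ (ρ t x) + ρ t x * deriv ζ (ρ t x)) * Torus.partialDeriv i (ρ t) x +
          ρ t x * ζ (ρ t x) * Torus.partialDeriv i (θ t) x)) * u t x i := by
    intro i
    exact partialDeriv_eq_of_hasDerivAt (((((cρ i).fun_mul
      ((((((cu i 0).fun_pow 2).fun_add ((cu i 1).fun_pow 2)).fun_add ((cu i 2).fun_pow 2)).div_const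
        2).fun_add ((cθ i).const_mul (3 / 2)))).fun_add
      (((cρ i).fun_mul (cθ i)).fun_mul (cζ i))).fun_mul (cu i i)).congr_deriv
      (by simp only [zero_smul, Torus.proj_zero, add_zero]; ring))
  rw [hA] at hen
  simp only [hB] at hen
  have hP1 := hE.timeDeriv_density_eq ht x
  have hP2 := fun k => hE.density_mul_timeDeriv_velocity_eq hJ hζ hρJ hp ht x k
  have hP20 := hP2 0
  have hP21 := hP2 1
  have hP22 := hP2 2
  simp only [Fin.sum_univ_three] at hen hP1 hP20 hP21 hP22 ⊢
  have hρ0 : ρ t x ≠ 0 := (hE.density_pos t ht x).ne'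
  have key : 3 / 2 * ρ t x * (Torus.timeDerivWithin (Ico 0 T) θ t x -
      (-(u t x 0 * Torus.partialDeriv 0 (θ t) x + u t x 1 * Torus.partialDeriv 1 (θ t) x +
          u t x 2 * Torus.partialDeriv 2 (θ t) x) -
        2 / 3 * (θ t x * ζ (ρ t x)) * (Torus.partialDeriv 0 (fun y => u t y 0) x +
          Torus.partialDeriv 1 (fun y => u t y 1) x + Torus.partialDeriv 2 (fun y => u t y 2) x))) =
      0 := by
    linear_combination hen -
      (((u t x 0) ^ 2 + (u t x 1) ^ 2 + (u t x 2) ^ 2) / 2 + 3 / 2 * θ t x) * hP1 -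
      (u t x 0) * hP20 - (u t x 1) * hP21 - (u t x 2) * hP22
  have h32 : (3 / 2 * ρ t x : ℝ) ≠ 0 := mul_ne_zero (by norm_num) hρ0
  exact sub_eq_zero.1 ((mul_eq_zero.1 key).resolve_left h32)

end Primitive

section Identity

variable {σ T : ℝ} {ρ θ ρ' θ' : ℝ → T3 → ℝ} {u u' : ℝ → T3 → V3} {ζ : ℝ → ℝ} {J : Set ℝ}

/-- Along a classical solution with density valued in the open set `J` on which `ζ` is smooth,
the composite field `ζ(ρ)` is jointly smooth on `[0, T) × 𝕋³`. [folklore] -/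
theorem HsEulerCalc.isSmoothSpaceTimeOn_comp_density (hρ : Torus.IsSmoothSpaceTimeOn (Ico 0 T) ρ)
    (hζ : ContDiffOn ℝ ∞ ζ J) (hρJ : ∀ t ∈ Ico 0 T, ∀ x, ρ t x ∈ J) :
    Torus.IsSmoothSpaceTimeOn (Ico 0 T) (fun s y => ζ (ρ s y)) := by
  refine hζ.comp hρ ?_
  rintro ⟨s, v⟩ hp
  exact hρJ s (mem_prod.1 hp).1 _

/-- The symmetrising weight `A = θ (ζ(ρ) + ρ ζ'(ρ)) / ρ` of a classical solution is jointly smooth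
on `[0, T) × 𝕋³` (`ρ > 0`). [folklore] -/
theorem IsHardSphereEulerSolution.isSmoothSpaceTimeOn_weightA
    (hE : IsHardSphereEulerSolution σ T ρ u θ) (hJ : IsOpen J)
    (hζ : ContDiffOn ℝ ∞ ζ J) (hρJ : ∀ t ∈ Ico 0 T, ∀ x, ρ t x ∈ J) :
    Torus.IsSmoothSpaceTimeOn (Ico 0 T)
      (fun s y => θ s y * (ζ (ρ s y) + ρ s y * deriv ζ (ρ s y)) / ρ s y) := by
  have h1 := isSmoothSpaceTimeOn_comp_density hE.smooth_density hζ hρJ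
  have h2 := isSmoothSpaceTimeOn_comp_density hE.smooth_density (hζ.deriv_of_isOpen hJ le_rfl) hρJ
  refine ContDiffOn.div (hE.smooth_temperature.mul (h1.add (hE.smooth_density.mul h2)))
    hE.smooth_density ?_
  rintro ⟨s, v⟩ hp
  exact (hE.density_pos s (mem_prod.1 hp).1 _).ne'

/-- The symmetrising weight `B = (3/2) ρ / θ` of a classical solution is jointly smooth on
`[0, T) × 𝕋³` (`θ > 0`). [folklore] -/
theorem IsHardSphereEulerSolution.isSmoothSpaceTimeOn_weightB
    (hE : IsHardSphereEulerSolution σ T ρ u θ) :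
    Torus.IsSmoothSpaceTimeOn (Ico 0 T) (fun s y => 3 / 2 * ρ s y / θ s y) := by
  refine ContDiffOn.div (contDiffOn_const.mul hE.smooth_density) hE.smooth_temperature ?_
  rintro ⟨s, v⟩ hp
  exact (hE.temperature_pos s (mem_prod.1 hp).1 _).ne'

/-- **The relative-energy balance, pointwise.** For two classical hard-sphere–Euler solutions on
`[0, T) × 𝕋³` with pressure law `p = ρ θ ζ(ρ)` (`ζ` smooth on an open set `J` containing the values
of both densities), the energy density `e = ½(A α² + ρ|w|² + B β²)` of the difference
`(α, w, β) = (ρ - ρ', u - u', θ - θ')` (weights `A = θ(ζ(ρ) + ρζ'(ρ))/ρ`, `B = 3ρ/(2θ)`) and the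
fluxes `Φᵢ = ½(A uᵢ α² + ρ uᵢ |w|² + B uᵢ β²) + θ(ζ(ρ) + ρζ'(ρ)) α wᵢ + ρ ζ(ρ) β wᵢ` satisfy
`∂ₜe + Σᵢ ∂ᵢΦᵢ = R` with the explicit zero-order remainder `R` displayed on the right
(a bilinear form in `α, β, wⱼ, ζ(ρ) - ζ(ρ'), γ(ρ) - γ(ρ')`, `γ = ζ + id·ζ'`). [folklore] -/
theorem IsHardSphereEulerSolution.relativeEnergy_balance :
    ∀ {σ T : ℝ} {ρ θ ρ' θ' : ℝ → T3 → ℝ} {u u' : ℝ → T3 → V3} {ζ : ℝ → ℝ} {J : Set ℝ},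
    IsHardSphereEulerSolution σ T ρ u θ → IsHardSphereEulerSolution σ T ρ' u' θ' → IsOpen J →
    ContDiffOn ℝ (⊤ : ℕ∞) ζ J → (∀ t ∈ Ico 0 T, ∀ x, ρ t x ∈ J) → (∀ t ∈ Ico 0 T, ∀ x, ρ' t x ∈ J) →
    (∀ t ∈ Ico 0 T, ∀ x, hsPressure σ (ρ t x) (θ t x) = ρ t x * θ t x * ζ (ρ t x)) →
    (∀ t ∈ Ico 0 T, ∀ x, hsPressure σ (ρ' t x) (θ' t x) = ρ' t x * θ' t x * ζ (ρ' t x)) →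
    ∀ {t : ℝ}, t ∈ Ico 0 T → ∀ x : T3,
    Torus.timeDerivWithin (Ico 0 T) (fun s y => 1 / 2 *
        (θ s y * (ζ (ρ s y) + ρ s y * deriv ζ (ρ s y)) / ρ s y * (ρ s y - ρ' s y) ^ 2 +
          ρ s y * ‖u s y - u' s y‖ ^ 2 + 3 / 2 * ρ s y / θ s y * (θ s y - θ' s y) ^ 2)) t x +
      ∑ i, Torus.partialDeriv i (fun y =>
        1 / 2 * (θ t y * (ζ (ρ t y) + ρ t y * deriv ζ (ρ t y)) / ρ t y * u t y i *
              (ρ t y - ρ' t y) ^ 2 +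
            ρ t y * u t y i * ‖u t y - u' t y‖ ^ 2 +
            3 / 2 * ρ t y / θ t y * u t y i * (θ t y - θ' t y) ^ 2) +
          θ t y * (ζ (ρ t y) + ρ t y * deriv ζ (ρ t y)) * (ρ t y - ρ' t y) * (u t y i - u' t y i) +
          ρ t y * ζ (ρ t y) * (θ t y - θ' t y) * (u t y i - u' t y i)) x =
      (1 / 2 * Torus.timeDerivWithin (Ico 0 T)
            (fun s y => θ s y * (ζ (ρ s y) + ρ s y * deriv ζ (ρ s y)) / ρ s y) t x -
          θ t x * (ζ (ρ t x) + ρ t x * deriv ζ (ρ t x)) / ρ t x *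
            ∑ i, Torus.partialDeriv i (fun y => u' t y i) x +
          1 / 2 * ∑ i, Torus.partialDeriv i
            (fun y => θ t y * (ζ (ρ t y) + ρ t y * deriv ζ (ρ t y)) / ρ t y * u t y i) x) *
        (ρ t x - ρ' t x) ^ 2 +
      (1 / 2 * Torus.timeDerivWithin (Ico 0 T) (fun s y => 3 / 2 * ρ s y / θ s y) t x -
          2 / 3 * (3 / 2 * ρ t x / θ t x) * ζ (ρ t x) *
            ∑ i, Torus.partialDeriv i (fun y => u' t y i) x +
          1 / 2 * ∑ i, Torus.partialDeriv i (fun y => 3 / 2 * ρ t y / θ t y * u t y i) x) *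
        (θ t x - θ' t x) ^ 2 +
      ∑ j, (-(θ t x * (ζ (ρ t x) + ρ t x * deriv ζ (ρ t x)) / ρ t x *
              Torus.partialDeriv j (ρ' t) x) -
            ∑ i, u' t x i * Torus.partialDeriv i (fun y => u' t y j) x -
            ζ (ρ t x) * Torus.partialDeriv j (θ' t) x -
            Torus.timeDerivWithin (Ico 0 T) (fun s y => u' s y j) t x +
            Torus.partialDeriv j (fun y => θ t y * (ζ (ρ t y) + ρ t y * deriv ζ (ρ t y))) x) *
          (ρ t x - ρ' t x) * (u t x j - u' t x j) +
      ∑ i, ∑ j, -(ρ t x * Torus.partialDeriv i (fun y => u' t y j) x) *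
          (u t x i - u' t x i) * (u t x j - u' t x j) +
      ∑ j, (-((ζ (ρ t x) + ρ t x * deriv ζ (ρ t x)) * Torus.partialDeriv j (ρ' t) x) -
            3 / 2 * ρ t x / θ t x * Torus.partialDeriv j (θ' t) x +
            Torus.partialDeriv j (fun y => ρ t y * ζ (ρ t y)) x) *
          (θ t x - θ' t x) * (u t x j - u' t x j) +
      ∑ j, -(θ' t x * Torus.partialDeriv j (ρ' t) x) *
          ((ζ (ρ t x) + ρ t x * deriv ζ (ρ t x)) - (ζ (ρ' t x) + ρ' t x * deriv ζ (ρ' t x))) *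
          (u t x j - u' t x j) +
      ∑ j, -(ρ' t x * Torus.partialDeriv j (θ' t) x) * (ζ (ρ t x) - ζ (ρ' t x)) *
          (u t x j - u' t x j) +
      -(2 / 3 * (3 / 2 * ρ t x / θ t x) * θ' t x * ∑ i, Torus.partialDeriv i (fun y => u' t y i) x) *
        (θ t x - θ' t x) * (ζ (ρ t x) - ζ (ρ' t x)) := by
  intro σ T ρ θ ρ' θ' u u' ζ J hE hE' hJ hζ hρJ hρJ' hp hp' t ht x
  have hU : UniqueDiffOn ℝ (Ico (0 : ℝ) T) := uniqueDiffOn_Ico 0 T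
  -- smooth slices
  have hρ1 : Torus.IsContDiff 1 (ρ t) := (hE.smooth_density.isSmooth_slice ht).isContDiff (by simp)
  have hθ1 : Torus.IsContDiff 1 (θ t) :=
    (hE.smooth_temperature.isSmooth_slice ht).isContDiff (by simp)
  have hu1 : Torus.IsContDiff 1 (u t) := (hE.smooth_velocity.isSmooth_slice ht).isContDiff (by simp)
  have huj1 : ∀ i, Torus.IsContDiff 1 (fun y => u t y i) := fun i => isContDiff_apply_coord hu1 i
  have hρ1' : Torus.IsContDiff 1 (ρ' t) :=
    (hE'.smooth_density.isSmooth_slice ht).isContDiff (by simp)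
  have hθ1' : Torus.IsContDiff 1 (θ' t) :=
    (hE'.smooth_temperature.isSmooth_slice ht).isContDiff (by simp)
  have hu1' : Torus.IsContDiff 1 (u' t) :=
    (hE'.smooth_velocity.isSmooth_slice ht).isContDiff (by simp)
  have huj1' : ∀ i, Torus.IsContDiff 1 (fun y => u' t y i) := fun i => isContDiff_apply_coord hu1' i
  have hζ1 : Torus.IsContDiff 1 (fun y => ζ (ρ t y)) :=
    (hζ.of_le (by simp)).comp_contDiff hρ1 fun v => hρJ t ht _
  have hζd1 : Torus.IsContDiff 1 (fun y => deriv ζ (ρ t y)) :=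
    ((hζ.deriv_of_isOpen (m := ∞) hJ le_rfl).of_le (by simp)).comp_contDiff hρ1 fun v => hρJ t ht _
  -- the weights and the pressure coefficients as jointly smooth fields, and their slices
  have hAf := hE.isSmoothSpaceTimeOn_weightA hJ hζ hρJ
  have hBf := hE.isSmoothSpaceTimeOn_weightB
  have hA1 : Torus.IsContDiff 1
      (fun y => θ t y * (ζ (ρ t y) + ρ t y * deriv ζ (ρ t y)) / ρ t y) :=
    (hAf.isSmooth_slice ht).isContDiff (by simp)
  have hB1 : Torus.IsContDiff 1 (fun y => 3 / 2 * ρ t y / θ t y) :=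
    (hBf.isSmooth_slice ht).isContDiff (by simp)
  have hpr1 : Torus.IsContDiff 1 (fun y => θ t y * (ζ (ρ t y) + ρ t y * deriv ζ (ρ t y))) :=
    (ContDiff.mul hθ1 (ContDiff.add hζ1 (ContDiff.mul hρ1 hζd1)) :)
  have hph1 : Torus.IsContDiff 1 (fun y => ρ t y * ζ (ρ t y)) := (hρ1.mul hζ1 :)
  have hAu1 : ∀ i, Torus.IsContDiff 1
      (fun y => θ t y * (ζ (ρ t y) + ρ t y * deriv ζ (ρ t y)) / ρ t y * u t y i) :=
    fun i => (hA1.mul (huj1 i) :)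
  have hBu1 : ∀ i, Torus.IsContDiff 1 (fun y => 3 / 2 * ρ t y / θ t y * u t y i) :=
    fun i => (hB1.mul (huj1 i) :)
  -- coordinate-line derivatives at `x`
  have cρ := fun i => hasDerivAt_coordLine hρ1 x i
  have cθ := fun i => hasDerivAt_coordLine hθ1 x i
  have cu := fun i k => hasDerivAt_coordLine (huj1 k) x i
  have cρ' := fun i => hasDerivAt_coordLine hρ1' x i
  have cθ' := fun i => hasDerivAt_coordLine hθ1' x i
  have cu' := fun i k => hasDerivAt_coordLine (huj1' k) x i
  have cAu := fun i => hasDerivAt_coordLine (hAu1 i) x i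
  have cBu := fun i => hasDerivAt_coordLine (hBu1 i) x i
  have cpr := fun i => hasDerivAt_coordLine hpr1 x i
  have cph := fun i => hasDerivAt_coordLine hph1 x i
  -- time-slice derivatives at `x`
  have sρ := hE.smooth_density.hasDerivWithinAt_slice ht x
  have sθ := hE.smooth_temperature.hasDerivWithinAt_slice ht x
  have su := fun k => (hE.smooth_velocity.apply k).hasDerivWithinAt_slice ht x
  have sρ' := hE'.smooth_density.hasDerivWithinAt_slice ht x
  have sθ' := hE'.smooth_temperature.hasDerivWithinAt_slice ht x
  have su' := fun k => (hE'.smooth_velocity.apply k).hasDerivWithinAt_slice ht x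
  have sA := hAf.hasDerivWithinAt_slice ht x
  have sB := hBf.hasDerivWithinAt_slice ht x
  -- `|u - u'|²` in coordinates
  have hnorm : ∀ s y, ‖u s y - u' s y‖ ^ 2 =
      (u s y 0 - u' s y 0) ^ 2 + (u s y 1 - u' s y 1) ^ 2 + (u s y 2 - u' s y 2) ^ 2 := by
    intro s y
    simp only [EuclideanSpace.norm_sq_eq, Fin.sum_univ_three, PiLp.sub_apply, Real.norm_eq_abs,
      sq_abs]
  simp only [hnorm]
  -- (1) the time derivative of the energy density
  rw [timeDerivWithin_eq_of_hasDerivWithinAt ((((sA.fun_mul ((sρ.fun_sub sρ').fun_pow 2)).fun_add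
    (sρ.fun_mul ((((su 0).fun_sub (su' 0)).fun_pow 2).fun_add (((su 1).fun_sub (su' 1)).fun_pow 2) |>.fun_add
      (((su 2).fun_sub (su' 2)).fun_pow 2)))).fun_add (sB.fun_mul ((sθ.fun_sub sθ').fun_pow 2))).const_mul
        (1 / 2)) (hU t ht)]
  -- (2) the divergence of the flux, coordinate by coordinate
  have hΦ : ∀ i, Torus.partialDeriv i (fun y =>
      1 / 2 * (θ t y * (ζ (ρ t y) + ρ t y * deriv ζ (ρ t y)) / ρ t y * u t y i *
            (ρ t y - ρ' t y) ^ 2 +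
          ρ t y * u t y i * ((u t y 0 - u' t y 0) ^ 2 + (u t y 1 - u' t y 1) ^ 2 +
            (u t y 2 - u' t y 2) ^ 2) +
          3 / 2 * ρ t y / θ t y * u t y i * (θ t y - θ' t y) ^ 2) +
        θ t y * (ζ (ρ t y) + ρ t y * deriv ζ (ρ t y)) * (ρ t y - ρ' t y) * (u t y i - u' t y i) +
        ρ t y * ζ (ρ t y) * (θ t y - θ' t y) * (u t y i - u' t y i)) x =
      1 / 2 * (Torus.partialDeriv i
              (fun y => θ t y * (ζ (ρ t y) + ρ t y * deriv ζ (ρ t y)) / ρ t y * u t y i) x *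
            (ρ t x - ρ' t x) ^ 2 +
          θ t x * (ζ (ρ t x) + ρ t x * deriv ζ (ρ t x)) / ρ t x * u t x i *
            (2 * (ρ t x - ρ' t x) * (Torus.partialDeriv i (ρ t) x - Torus.partialDeriv i (ρ' t) x)) +
          ((ρ t x * Torus.partialDeriv i (fun y => u t y i) x +
              Torus.partialDeriv i (ρ t) x * u t x i) *
            ((u t x 0 - u' t x 0) ^ 2 + (u t x 1 - u' t x 1) ^ 2 + (u t x 2 - u' t x 2) ^ 2) +
          ρ t x * u t x i * (2 * (u t x 0 - u' t x 0) * (Torus.partialDeriv i (fun y => u t y 0) x -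
              Torus.partialDeriv i (fun y => u' t y 0) x) +
            2 * (u t x 1 - u' t x 1) * (Torus.partialDeriv i (fun y => u t y 1) x -
              Torus.partialDeriv i (fun y => u' t y 1) x) +
            2 * (u t x 2 - u' t x 2) * (Torus.partialDeriv i (fun y => u t y 2) x -
              Torus.partialDeriv i (fun y => u' t y 2) x))) +
          (Torus.partialDeriv i (fun y => 3 / 2 * ρ t y / θ t y * u t y i) x * (θ t x - θ' t x) ^ 2 +
            3 / 2 * ρ t x / θ t x * u t x i *
              (2 * (θ t x - θ' t x) * (Torus.partialDeriv i (θ t) x - Torus.partialDeriv i (θ' t) x)))) +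
        (Torus.partialDeriv i (fun y => θ t y * (ζ (ρ t y) + ρ t y * deriv ζ (ρ t y))) x *
            (ρ t x - ρ' t x) * (u t x i - u' t x i) +
          θ t x * (ζ (ρ t x) + ρ t x * deriv ζ (ρ t x)) *
            ((Torus.partialDeriv i (ρ t) x - Torus.partialDeriv i (ρ' t) x) * (u t x i - u' t x i) +
              (ρ t x - ρ' t x) * (Torus.partialDeriv i (fun y => u t y i) x -
                Torus.partialDeriv i (fun y => u' t y i) x))) +
        (Torus.partialDeriv i (fun y => ρ t y * ζ (ρ t y)) x * (θ t x - θ' t x) * (u t x i - u' t x i) +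
          ρ t x * ζ (ρ t x) *
            ((Torus.partialDeriv i (θ t) x - Torus.partialDeriv i (θ' t) x) * (u t x i - u' t x i) +
              (θ t x - θ' t x) * (Torus.partialDeriv i (fun y => u t y i) x -
                Torus.partialDeriv i (fun y => u' t y i) x))) := by
    intro i
    exact partialDeriv_eq_of_hasDerivAt ((((((cAu i).fun_mul (((cρ i).fun_sub (cρ' i)).fun_pow 2)).fun_add
      (((cρ i).fun_mul (cu i i)).fun_mul (((((cu i 0).fun_sub (cu' i 0)).fun_pow 2).fun_add
        (((cu i 1).fun_sub (cu' i 1)).fun_pow 2)).fun_add (((cu i 2).fun_sub (cu' i 2)).fun_pow 2)))).fun_add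
      ((cBu i).fun_mul (((cθ i).fun_sub (cθ' i)).fun_pow 2))).const_mul (1 / 2) |>.fun_add
      (((cpr i).fun_mul ((cρ i).fun_sub (cρ' i))).fun_mul ((cu i i).fun_sub (cu' i i))) |>.fun_add
      (((cph i).fun_mul ((cθ i).fun_sub (cθ' i))).fun_mul ((cu i i).fun_sub (cu' i i)))).congr_deriv
      (by simp only [zero_smul, Torus.proj_zero, add_zero]; ring))
  simp only [hΦ]
  -- (3) the primitive equations of both solutions and the symmetriser relations
  have hP1 := hE.timeDeriv_density_eq ht x
  have hP1' := hE'.timeDeriv_density_eq ht x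
  have hP2 := fun k => hE.density_mul_timeDeriv_velocity_eq hJ hζ hρJ hp ht x k
  have hP2' := fun k => hE'.density_mul_timeDeriv_velocity_eq hJ hζ hρJ' hp' ht x k
  have hP20 := hP2 0
  have hP21 := hP2 1
  have hP22 := hP2 2
  have hP20' := hP2' 0
  have hP21' := hP2' 1
  have hP22' := hP2' 2
  have hP3 := hE.timeDeriv_temperature_eq hJ hζ hρJ hp ht x
  have hP3' := hE'.timeDeriv_temperature_eq hJ hζ hρJ' hp' ht x
  have hρ0 : ρ t x ≠ 0 := (hE.density_pos t ht x).ne'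
  have hθ0 : θ t x ≠ 0 := (hE.temperature_pos t ht x).ne'
  have hA : θ t x * (ζ (ρ t x) + ρ t x * deriv ζ (ρ t x)) / ρ t x * ρ t x =
      θ t x * (ζ (ρ t x) + ρ t x * deriv ζ (ρ t x)) := div_mul_cancel₀ _ hρ0
  have hB : 2 * (3 / 2 * ρ t x / θ t x) * θ t x = 3 * ρ t x := by
    field_simp
  simp only [Fin.sum_univ_three] at hP1 hP1' hP20 hP21 hP22 hP20' hP21' hP22' hP3 hP3'
  repeat rw [Fin.sum_univ_three]
  linear_combination
    (θ t x * (ζ (ρ t x) + ρ t x * deriv ζ (ρ t x)) / ρ t x * (ρ t x - ρ' t x) +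
        1 / 2 * ((u t x 0 - u' t x 0) ^ 2 + (u t x 1 - u' t x 1) ^ 2 + (u t x 2 - u' t x 2) ^ 2)) *
      hP1 -
    θ t x * (ζ (ρ t x) + ρ t x * deriv ζ (ρ t x)) / ρ t x * (ρ t x - ρ' t x) * hP1' +
    (u t x 0 - u' t x 0) * hP20 + (u t x 1 - u' t x 1) * hP21 + (u t x 2 - u' t x 2) * hP22 -
    (u t x 0 - u' t x 0) * hP20' - (u t x 1 - u' t x 1) * hP21' - (u t x 2 - u' t x 2) * hP22' +
    3 / 2 * ρ t x / θ t x * (θ t x - θ' t x) * hP3 -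
    3 / 2 * ρ t x / θ t x * (θ t x - θ' t x) * hP3' -
    (ρ t x - ρ' t x) * ((Torus.partialDeriv 0 (fun y => u t y 0) x -
        Torus.partialDeriv 0 (fun y => u' t y 0) x) +
      (Torus.partialDeriv 1 (fun y => u t y 1) x - Torus.partialDeriv 1 (fun y => u' t y 1) x) +
      (Torus.partialDeriv 2 (fun y => u t y 2) x - Torus.partialDeriv 2 (fun y => u' t y 2) x)) * hA -
    1 / 3 * ζ (ρ t x) * (θ t x - θ' t x) * ((Torus.partialDeriv 0 (fun y => u t y 0) x -
        Torus.partialDeriv 0 (fun y => u' t y 0) x) +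
      (Torus.partialDeriv 1 (fun y => u t y 1) x - Torus.partialDeriv 1 (fun y => u' t y 1) x) +
      (Torus.partialDeriv 2 (fun y => u t y 2) x - Torus.partialDeriv 2 (fun y => u' t y 2) x)) * hB

end Identity

end Literature.MathematicalPhysics.KineticTheory

end
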